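import Summits.PneNP.PneNP.Theorems.SzkEntropyPeaWorstToAvgStubOrbitKitGLSampler
import HarnessLib

/-!
# Orbit kit for `orbit-pair-rsr`, V: the law of the sampled group element

Helper file of the stub `stub_orbitKit` (crux `SzkEntropy.PeaWorstToAvg`, line `orbit-pair-rsr`).
Quantitative facts about the law of the group element `(A, b, B, c)` read off the coins by
`gA, gb, gB, gc` (`…StubOrbitKitGLSampler.lean`):

* `glCount_eq_prod` — `glCount s = |GL_s(F₂)| = ∏_{i<s} (2^s - 2^i)` (Mathlib's `Matrix.card_GL_field`
  through the read-out bijection), and the density bound `four_mul_glCount_ge`: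
  `|GL_s(F₂)| ≥ 2^{s²}/4` (`∏_{j ≥ 1} (1 - 2^{-j}) ≥ ¼`, by the Weierstrass product inequality);
* `cnt_gT_eq` — the fibres of the typed read-out `gT` over `{0,1}^{need + d}` factor as
  `selCount s t A · selCount m t B · 2^d` (independent coin blocks), whence the pointwise lower bound
  `gTLaw_ge` on the law of `gT` in terms of `σ_s^t`, `σ_m^t` (`σ` = density of singular matrices `≤ ¾`).

References: folklore; S. Arora, B. Barak, *Computational Complexity*, CUP 2009, §7.1.
-/

namespace Summit.PneNP.PneNP.Cruxes.PeaWorstToAvg.OrbitPairRsr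

set_option linter.dupNamespace false -- Summit.PneNP.PneNP: summit = sub-problem (D-0017)

open Literature.Computability.Complexity Literature.Computability.MetaComplexity Finset

namespace OKit

/-! ### `|GL_s(F₂)|` and its density -/

/-- Units of a monoid are its invertible elements. [folklore] -/
noncomputable def unitsEquivIsUnit (M : Type*) [Monoid M] : Mˣ ≃ {x : M // IsUnit x} where
  toFun u := ⟨u, u.isUnit⟩
  invFun x := x.2.unit
  left_inv _ := IsUnit.unit_of_val_units _
  right_inv x := Subtype.ext x.2.unit_spec

/-- `glCount s` is the number of invertible `s × s` matrices over `F₂`. [folklore] -/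
theorem glCount_eq_card (s : ℕ) :
    glCount s = Fintype.card {A : Matrix (Fin s) (Fin s) (ZMod 2) // IsUnit A} := by
  classical
  have h1 : glCount s = cnt (s * s) {u | IsUnit (matT s (readMat s u))} :=
    cnt_congr fun u _ => by rw [Set.mem_setOf_eq, inv_readMat_iff]; rfl
  have h2 : cnt (s * s) {u | IsUnit (matT s (readMat s u))} =
      (univ.filter fun A : Matrix (Fin s) (Fin s) (ZMod 2) => IsUnit A).card := by
    unfold cnt
    refine Finset.card_bij (fun r _ => matT s (readMat s r.toList)) (fun r hr => by simpa using hr)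
      (fun r₁ _ r₂ _ h => (readMat_bijective s).1 h) fun A hA => ?_
    obtain ⟨r, hr⟩ := (readMat_bijective s).2 A
    refine ⟨r, ?_, hr⟩
    simp only [mem_filter, mem_univ, true_and, Set.mem_setOf_eq] at hA ⊢
    simp only at hr
    rwa [hr]
  rw [h1, h2, Fintype.card_subtype]

/-- **`glCount s = |GL_s(F₂)| = ∏_{i<s} (2^s - 2^i)`.** [folklore] -/
theorem glCount_eq_prod (s : ℕ) : glCount s = ∏ i : Fin s, (2 ^ s - 2 ^ (i : ℕ)) := by
  rw [glCount_eq_card, ← Fintype.card_congr (unitsEquivIsUnit (Matrix (Fin s) (Fin s) (ZMod 2))),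
    ← Nat.card_eq_fintype_card, Matrix.card_GL_field, ZMod.card]

/-- **Weierstrass product inequality**: `1 - Σ aᵢ ≤ ∏ (1 - aᵢ)` for `aᵢ ∈ [0, 1]`. [folklore] -/
theorem one_sub_sum_le_prod (a : ℕ → ℝ) (h0 : ∀ i, 0 ≤ a i) (h1 : ∀ i, a i ≤ 1) (n : ℕ) :
    1 - ∑ i ∈ range n, a i ≤ ∏ i ∈ range n, (1 - a i) := by
  induction n with
  | zero => simp
  | succ n ih =>
    rw [sum_range_succ, prod_range_succ]
    have hP1 : ∏ i ∈ range n, (1 - a i) ≤ 1 := prod_le_one (fun i _ => sub_nonneg.2 (h1 i)) fun i _ => by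
      linarith [h0 i]
    have hP0 : 0 ≤ ∏ i ∈ range n, (1 - a i) := prod_nonneg fun i _ => sub_nonneg.2 (h1 i)
    nlinarith [h0 n, h1 n]

/-- `∏_{i<s} (1 - 2^{-(i+1)}) ≥ ¼`. [folklore] -/
theorem prod_one_sub_half_pow_ge (s : ℕ) : (1 / 4 : ℝ) ≤ ∏ i ∈ range s, (1 - (1 / 2 : ℝ) ^ (i + 1)) := by
  cases s with
  | zero => norm_num
  | succ n =>
    rw [prod_range_succ']
    have hgeom : ∑ i ∈ range n, (1 / 2 : ℝ) ^ (i + 1 + 1) ≤ 1 / 2 := by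
      have : ∑ i ∈ range n, (1 / 2 : ℝ) ^ (i + 1 + 1) = (1 / 4) * ∑ i ∈ range n, (1 / 2 : ℝ) ^ i := by
        rw [mul_sum]; refine sum_congr rfl fun i _ => by ring
      have hs : ∑ i ∈ range n, (1 / 2 : ℝ) ^ i ≤ 2 := by
        rw [geom_sum_eq (by norm_num)]
        have h0 : (0 : ℝ) ≤ (1 / 2) ^ n := by positivity
        have h : ((1 / 2 : ℝ) ^ n - 1) / (1 / 2 - 1) = 2 - 2 * (1 / 2) ^ n := by ring
        rw [h]; linarith
      rw [this]; linarith
    have hW := one_sub_sum_le_prod (fun i => (1 / 2 : ℝ) ^ (i + 1 + 1)) (fun i => by positivity)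
      (fun i => pow_le_one₀ (by norm_num) (by norm_num)) n
    have hP0 : 0 ≤ ∏ i ∈ range n, (1 - (1 / 2 : ℝ) ^ (i + 1 + 1)) :=
      prod_nonneg fun i _ => sub_nonneg.2 (pow_le_one₀ (by norm_num) (by norm_num))
    norm_num at hW ⊢
    nlinarith [hW, hP0, hgeom]

/-- `2^s · 2^{-(s-j)} = 2^j`. [folklore] -/
theorem two_pow_mul_half_pow {j s : ℕ} (h : j ≤ s) : (2 : ℝ) ^ s * (1 / 2) ^ (s - j) = 2 ^ j := by
  obtain ⟨k, rfl⟩ := Nat.exists_eq_add_of_le h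
  rw [Nat.add_sub_cancel_left, pow_add, mul_assoc, ← mul_pow]; norm_num

/-- **Density of `GL_s(F₂)`**: `4 · |GL_s(F₂)| ≥ 2^{s²}`. [folklore] -/
theorem four_mul_glCount_ge (s : ℕ) : (2 : ℝ) ^ (s * s) ≤ 4 * glCount s := by
  rw [glCount_eq_prod, Nat.cast_prod]
  have hcast : ∀ i : Fin s, ((2 ^ s - 2 ^ (i : ℕ) : ℕ) : ℝ) = (2 : ℝ) ^ s * (1 - (1 / 2 : ℝ) ^ (s - i)) := by
    intro i
    have hle : 2 ^ (i : ℕ) ≤ 2 ^ s := Nat.pow_le_pow_right (by norm_num) i.isLt.le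
    rw [Nat.cast_sub hle, Nat.cast_pow, Nat.cast_pow, Nat.cast_ofNat, mul_sub, mul_one,
      two_pow_mul_half_pow i.isLt.le]
  simp_rw [hcast]
  rw [prod_mul_distrib, prod_const, Finset.card_univ, Fintype.card_fin, ← pow_mul,
    Fin.prod_univ_eq_prod_range (fun i => (1 - (1 / 2 : ℝ) ^ (s - i))) s]
  have hrefl : ∏ i ∈ range s, (1 - (1 / 2 : ℝ) ^ (s - i)) = ∏ i ∈ range s, (1 - (1 / 2 : ℝ) ^ (i + 1)) := by
    rw [← prod_range_reflect (fun i => (1 - (1 / 2 : ℝ) ^ (i + 1))) s]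
    refine prod_congr rfl fun i hi => ?_
    rw [mem_range] at hi
    congr 2; omega
  rw [hrefl]
  have h4 := prod_one_sub_half_pow_ge s
  have h0 : (0 : ℝ) ≤ 2 ^ (s * s) := by positivity
  nlinarith [h4, h0]

/-- The density of singular matrices: `singCount s ≤ ¾ · 2^{s²}`. [folklore] -/
theorem singCount_le (s : ℕ) : (singCount s : ℝ) ≤ 3 / 4 * 2 ^ (s * s) := by
  have h := glCount_add_singCount s
  have h' : (glCount s : ℝ) + singCount s = 2 ^ (s * s) := by exact_mod_cast h
  have := four_mul_glCount_ge s
  linarith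

/-! ### The law of the read-out -/

/-- **Independent coin blocks**: the fibres of the typed read-out `gT` over coin strings of length
`need s m t + d` factor as `selCount s t A · selCount m t B · 2^d` (the shifts `b`, `c` are read
bijectively). [cite: AroraBarak2009, §7.1] -/
theorem cnt_gT_eq (s m t d : ℕ)
    (g : Matrix (Fin s) (Fin s) (ZMod 2) × (Fin s → ZMod 2) × Matrix (Fin m) (Fin m) (ZMod 2) × (Fin m → ZMod 2)) :
    cnt (need s m t + d) {r | gT s m t r = g} = selCount s t g.1 * (selCount m t g.2.2.1 * 2 ^ d) := by
  obtain ⟨A, b, B, c⟩ := g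
  have hN : need s m t + d = t * (s * s) + (s + (t * (m * m) + (m + d))) := by rw [need]; ring
  rw [hN]
  have hset : {r : List Bool | gT s m t r = (A, b, B, c)} =
      {r | r.take (t * (s * s)) ∈ {u | matT s (sel s t u) = A} ∧ r.drop (t * (s * s)) ∈
        {r₁ | r₁.take s ∈ {u | vecT s (readVec s u) = b} ∧ r₁.drop s ∈
          {r₂ | r₂.take (t * (m * m)) ∈ {u | matT m (sel m t u) = B} ∧ r₂.drop (t * (m * m)) ∈
            {r₃ : List Bool | r₃.take m ∈ {u | vecT m (readVec m u) = c}}}}} := by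
    ext r
    simp only [Set.mem_setOf_eq, gT, gA, gb, gB, gc, Prod.mk.injEq]
  rw [hset, cnt_take_and_drop, cnt_take_and_drop, cnt_take_and_drop, cnt_take, cnt_readVec_eq_one,
    cnt_readVec_eq_one, one_mul, one_mul]
  rfl

/-- The law of the sampler, pointwise in `ℝ`: `Pr[sel = A] ≥ (1 - σ^t)/|GL_s|` for invertible `A`.
[folklore] -/
theorem selCount_div_ge (s t : ℕ) {A : Matrix (Fin s) (Fin s) (ZMod 2)} (hA : IsUnit A) :
    (1 - (singCount s / 2 ^ (s * s) : ℝ) ^ t) / glCount s ≤ selCount s t A / 2 ^ (t * (s * s)) := by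
  have hb := selCount_bound s t hA
  have hb' : (2 : ℝ) ^ (t * (s * s)) ≤ selCount s t A * glCount s + singCount s ^ t := by exact_mod_cast hb
  have hgl : (0 : ℝ) < glCount s := by
    have := four_mul_glCount_ge s
    have h0 : (0 : ℝ) < 2 ^ (s * s) := by positivity
    linarith
  rw [div_pow, ← pow_mul, mul_comm (s * s) t, div_le_div_iff₀ hgl (by positivity), sub_mul, one_mul,
    div_mul_cancel₀ _ (by positivity)]
  linarith

/-- `σ^t ≤ 1`. [folklore] -/
theorem one_sub_sigma_pow_nonneg (s t : ℕ) : 0 ≤ 1 - (singCount s / 2 ^ (s * s) : ℝ) ^ t :=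
  sub_nonneg.2 (pow_le_one₀ (by positivity) (by
    rw [div_le_one (by positivity)]; have := singCount_le s; linarith))

/-- The probability that no candidate out of `t` is invertible: `σ^t ≤ (¾)^t`. [folklore] -/
theorem sigma_pow_le (s t : ℕ) : (singCount s / 2 ^ (s * s) : ℝ) ^ t ≤ (3 / 4) ^ t :=
  pow_le_pow_left₀ (by positivity) (by
    rw [div_le_iff₀ (by positivity)]
    exact singCount_le s) t

/-! ### The group of pairs of invertible affine maps, and the law of the read-out on it -/

/-- Tuples `(A, b, B, c)`: a pair of affine maps of `F₂ˢ` and `F₂^m`. [cite: Patarin1996, §2] -/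
abbrev Tup (s m : ℕ) : Type :=
  Matrix (Fin s) (Fin s) (ZMod 2) × (Fin s → ZMod 2) × Matrix (Fin m) (Fin m) (ZMod 2) × (Fin m → ZMod 2)

/-- The group `AGL_s(F₂) × AGL_m(F₂)` as the invertible tuples. [cite: Patarin1996, §2] -/
def Grp (s m : ℕ) : Type := {g : Tup s m // IsUnit g.1 ∧ IsUnit g.2.2.1}

/-- The group is finite. [folklore] -/
noncomputable instance instFintypeGrp (s m : ℕ) : Fintype (Grp s m) := by
  classical exact Subtype.fintype _

/-- The group as a product. [folklore] -/
noncomputable def grpEquiv (s m : ℕ) : Grp s m ≃ {A : Matrix (Fin s) (Fin s) (ZMod 2) // IsUnit A} × (Fin s → ZMod 2) ×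
    {B : Matrix (Fin m) (Fin m) (ZMod 2) // IsUnit B} × (Fin m → ZMod 2) where
  toFun g := (⟨g.1.1, g.2.1⟩, g.1.2.1, ⟨g.1.2.2.1, g.2.2⟩, g.1.2.2.2)
  invFun p := ⟨(p.1.1, p.2.1, p.2.2.1.1, p.2.2.2), p.1.2, p.2.2.1.2⟩
  left_inv _ := rfl
  right_inv _ := rfl

/-- **`|AGL_s × AGL_m| = |GL_s| 2^s |GL_m| 2^m`.** [folklore] -/
theorem card_Grp (s m : ℕ) : Fintype.card (Grp s m) = glCount s * 2 ^ s * (glCount m * 2 ^ m) := by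
  classical
  rw [Fintype.card_congr (grpEquiv s m), Fintype.card_prod, Fintype.card_prod, Fintype.card_prod,
    ← glCount_eq_card, ← glCount_eq_card, Fintype.card_fun, Fintype.card_fun, ZMod.card, Fintype.card_fin,
    Fintype.card_fin, mul_assoc]

/-- The typed read-out, valued in the group (the sampled matrices are invertible). [folklore] -/
def gT' (s m t : ℕ) (r : List Bool) : Grp s m := ⟨gT s m t r, gT_isUnit s m t r⟩

/-- The law of the read-out under `N` uniform coins: `Pr_r[gT r = g]`. [folklore] -/
noncomputable def law (s m t N : ℕ) (g : Grp s m) : ℝ := cnt N {r | gT' s m t r = g} / 2 ^ N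

/-- **Fibre decomposition**: the number of coin strings whose read-out satisfies `P` is the sum over
the group of the fibre sizes. [folklore] -/
theorem cnt_gT'_eq_sum (s m t N : ℕ) (P : Grp s m → Prop) [DecidablePred P] :
    (cnt N {r | P (gT' s m t r)} : ℝ) = ∑ g : Grp s m, if P g then (cnt N {r | gT' s m t r = g} : ℝ) else 0 := by
  classical
  unfold cnt
  rw [Finset.card_eq_sum_card_fiberwise (f := fun r : List.Vector Bool N => gT' s m t r.toList) (t := univ)
    fun _ _ => mem_univ _, Nat.cast_sum]
  refine sum_congr rfl fun g _ => ?_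
  split_ifs with h
  · congr 2; ext r; simp only [mem_filter, mem_univ, true_and, Set.mem_setOf_eq]
    exact ⟨fun h' => h'.2, fun h' => ⟨h' ▸ h, h'⟩⟩
  · rw [Nat.cast_eq_zero, Finset.card_eq_zero, Finset.filter_eq_empty_iff]
    intro r hr hrg
    simp only [mem_filter, mem_univ, true_and, Set.mem_setOf_eq] at hr
    exact h (hrg ▸ hr)

/-- The law is a probability distribution. [folklore] -/
theorem sum_law (s m t N : ℕ) : ∑ g : Grp s m, law s m t N g = 1 := by
  classical
  have h := cnt_gT'_eq_sum s m t N (fun _ => True)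
  simp only [if_true] at h
  rw [cnt_eq_two_pow_of_forall (E := {r | True}) (fun _ _ => trivial), Nat.cast_pow, Nat.cast_ofNat] at h
  simp only [law]
  rw [← sum_div, ← h, div_self (by positivity)]

/-- **Pointwise lower bound on the law**: with enough coins,
`Pr[gT = g] ≥ u := (1-σ_s^t)/|GL_s| · 2^{-s} · (1-σ_m^t)/|GL_m| · 2^{-m}` for every group element.
[folklore] -/
theorem law_ge {s m t N : ℕ} (hN : need s m t ≤ N) (g : Grp s m) :
    (1 - (singCount s / 2 ^ (s * s) : ℝ) ^ t) / glCount s * (1 / 2 ^ s) *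
      ((1 - (singCount m / 2 ^ (m * m) : ℝ) ^ t) / glCount m * (1 / 2 ^ m)) ≤ law s m t N g := by
  obtain ⟨d, rfl⟩ := Nat.exists_eq_add_of_le hN
  have hset : {r : List Bool | gT' s m t r = g} = {r | gT s m t r = g.1} := by
    ext r; exact Subtype.ext_iff
  rw [law, hset, cnt_gT_eq]
  have hsplit : ((selCount s t g.1.1 * (selCount m t g.1.2.2.1 * 2 ^ d) : ℕ) : ℝ) / 2 ^ (need s m t + d) =
      selCount s t g.1.1 / 2 ^ (t * (s * s)) * (1 / 2 ^ s) *
        (selCount m t g.1.2.2.1 / 2 ^ (t * (m * m)) * (1 / 2 ^ m)) := by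
    rw [need]; push_cast
    field_simp
    ring
  rw [hsplit]
  have h1 := selCount_div_ge s t g.2.1
  have h2 := selCount_div_ge m t g.2.2
  have h1' : 0 ≤ (1 - (singCount s / 2 ^ (s * s) : ℝ) ^ t) / glCount s :=
    div_nonneg (one_sub_sigma_pow_nonneg s t) (by positivity)
  have h2' : 0 ≤ (1 - (singCount m / 2 ^ (m * m) : ℝ) ^ t) / glCount m :=
    div_nonneg (one_sub_sigma_pow_nonneg m t) (by positivity)
  gcongr

/-- The lower bound carries total mass `u · |G| = (1 - σ_s^t)(1 - σ_m^t) ≥ 1 - 2 (¾)^t`. [folklore] -/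
theorem one_sub_u_card_le (s m t : ℕ) :
    1 - (1 - (singCount s / 2 ^ (s * s) : ℝ) ^ t) / glCount s * (1 / 2 ^ s) *
      ((1 - (singCount m / 2 ^ (m * m) : ℝ) ^ t) / glCount m * (1 / 2 ^ m)) * Fintype.card (Grp s m) ≤
      2 * (3 / 4 : ℝ) ^ t := by
  rw [card_Grp]
  have hgs : (0 : ℝ) < glCount s := by
    have := four_mul_glCount_ge s; have h0 : (0 : ℝ) < 2 ^ (s * s) := by positivity
    linarith
  have hgm : (0 : ℝ) < glCount m := by
    have := four_mul_glCount_ge m; have h0 : (0 : ℝ) < 2 ^ (m * m) := by positivity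
    linarith
  have hσs := sigma_pow_le s t
  have hσm := sigma_pow_le m t
  have h0s : (0 : ℝ) ≤ (singCount s / 2 ^ (s * s)) ^ t := by positivity
  have h0m : (0 : ℝ) ≤ (singCount m / 2 ^ (m * m)) ^ t := by positivity
  have key : (1 - (singCount s / 2 ^ (s * s) : ℝ) ^ t) / glCount s * (1 / 2 ^ s) *
      ((1 - (singCount m / 2 ^ (m * m) : ℝ) ^ t) / glCount m * (1 / 2 ^ m)) *
        ((glCount s * 2 ^ s * (glCount m * 2 ^ m) : ℕ) : ℝ) =
      (1 - (singCount s / 2 ^ (s * s) : ℝ) ^ t) * (1 - (singCount m / 2 ^ (m * m) : ℝ) ^ t) := by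
    push_cast
    field_simp
  rw [key]
  nlinarith [mul_nonneg h0s h0m]

end OKit

/-- **Pointwise lower bound on the law of the read-out (anchor of the helper file).** [folklore] -/
theorem orbitKit_law_ge {s m t N : ℕ} (hN : OKit.need s m t ≤ N) (g : OKit.Grp s m) :
    (1 - (OKit.singCount s / 2 ^ (s * s) : ℝ) ^ t) / OKit.glCount s * (1 / 2 ^ s) *
      ((1 - (OKit.singCount m / 2 ^ (m * m) : ℝ) ^ t) / OKit.glCount m * (1 / 2 ^ m)) ≤ OKit.law s m t N g :=
  OKit.law_ge hN g

end Summit.PneNP.PneNP.Cruxes.PeaWorstToAvg.OrbitPairRsr
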